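import Summits.Langlands.Langlands.Theorems.FrobeniusUnitCarving
import Summits.Langlands.Langlands.Theses.FrobeniusUnitCarving
import Literature.NumberTheory.GaloisRepresentations.DeRhamLAdicCharacterHeckeReduction
import HarnessLib

/-!
# FU (`FrobeniusUnitCarving.FrobeniusUnits`, stmt-Langlands-27434) — the RANK-ONE sector is ONE named fact away

Support file for the deciding crux FU of route `FrobeniusUnitCarving` (decomp-langlands lens-6, gen 35): the
registered birth skeleton `Cruxes/FrobeniusUnits/Lines/birth.lean` cuts FU into `stub_rankOne` (`n = 1`),
`stub_rankTwo`, `stub_higherRank`.  This file turns `stub_rankOne` into a KERNEL EDGE to the catalogued named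
fact `FramedGaloisRep.exists_heckeCharacter_of_isDeRhamFramed` (Patrikis 2019 Prop. 2.2.1; Serre 1968 Ch. III
§2.3 Thm. 2 + App. A: a de Rham `ℓ`-adic character is the avatar of an algebraic Hecke character), and —
through the tree's reduction `FramedGaloisRep.exists_heckeCharacter_of_isDeRhamFramed_of_local` — to Tate's
LOCAL theorem alone (a de Rham character of a `p`-adic field is locally algebraic; Serre III App. A6 Cor. 2).

## What is proved (0 sorry; all number fields `K`, no CM / totally-complex restriction)

* `norm_symm_valueAtUniformizer_inv_eq_one`, `norm_symm_valueAtUniformizer_eq_one` — **Weil's unit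
  theorem, `λ`-adic form, UNCONDITIONAL**: for an algebraic Hecke character `χ` of `K`, every prime `ℓ'`,
  every `ι' : ℚ̄_{ℓ'} ≃ ℂ` and every finite place `v ∤ ℓ'` at which `χ` is unramified,
  `‖ι'⁻¹(χ(ϖ_v))‖_{ℓ'} = 1` — i.e. the uniformizer value `χ(ϖ_v)` is an `ℓ'`-adic unit for every `ℓ'` not
  under `v` (Weil 1956: values of type-`A₀` characters generate ideals supported above `p_v`).  Proof: `ι'⁻¹(χ(ϖ_v))⁻¹`
  is THE Frobenius eigenvalue at `v` of the PROVED `ℓ'`-adic avatar `χ_{ℓ',ι'}`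
  (`HeckeCharacter.IsAlgebraic.exists_lAdic`, Weil), hence a unit by compactness of `Γ_K`
  (`FramedRep.norm_eq_one_of_isRoot_charpoly`).
* `hasUnitFrobenius_of_heckeDictionary` — **the kernel, UNCONDITIONAL**: a rank-one `ρ : Γ_K → GL₁(ℚ̄_ℓ)`
  whose Frobenii match an algebraic Hecke character almost everywhere (`ρ(Frob_v) = ι⁻¹(χ(ϖ_v))⁻¹`) has unit
  Frobenius avatars — `HasUnitFrobenius K ℓ ι ρ`, the FU conclusion literally — because it sits in the full
  compatible family `(χ_{ℓ',ι'})_{ℓ',ι'}` (`hasUnitFrobenius_of_compatibleFamily`, landed g33).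
* `hasUnitFrobenius_of_isAvatar`, `exists_avatar_hasUnitFrobenius` — **unconditional rung**: every `ℓ`-adic
  avatar of every algebraic Hecke character of every number field satisfies the FU conclusion.
* `hasUnitFrobenius_rankOne_of_namedFact` / `rankOne_of_namedFact` — **FU at `n = 1`** (the skeleton's
  `stub_rankOne` text VERBATIM, irreducibility and unramified-a.e. clauses unused) from the named fact BY NAME.
* `rankOne_of_local` — the same from Tate's local theorem `hloc` ALONE (binder copied verbatim from
  `DeRhamLAdicCharacterHeckeReduction`; `hloc` needs Sen theory, not in the tree).

So the `n = 1` sector of FU is exactly as hard as the rank-one automorphy leaf R1 of the rank ladders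
(`PrimitiveRankLadderRankOneAutomorphyOfTateLocal.rankOneAutomorphy_of_local` has the same single input): one
local `p`-adic Hodge theory statement.  The de Rham hypothesis is essential (the character `x ↦ x^s`,
`s ∈ ℤ_ℓ ∖ ℤ`, of `Gal(ℚ(ζ_{ℓ^∞})/ℚ)` has non-unit companions nowhere — it has no companions).

## References

* [Patrikis2019] S. Patrikis, *Variations on a theorem of Tate*, Mem. AMS 1238 (2019) = arXiv:1207.6724, Prop. 2.2.1.
* [SerreAbelianLadic1968] J.-P. Serre, *Abelian ℓ-adic representations and elliptic curves* (1968), Ch. I §2.3,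
  Ch. II §3.4, Ch. III §2.3 Thm. 2, App. A6 Cor. 2.
* [Weil1956Hecke] A. Weil, *On a certain type of characters of the idèle-class group of an algebraic
  number-field* (1956), pp. 1–7 (values of type-`A₀` characters are algebraic; their `λ`-adic avatars).
* [Conrad2011LiftingGlobal] B. Conrad, *Lifting global representations with local properties* (2011), App. B, Prop. B.4.
-/

set_option linter.dupNamespace false

open scoped NumberField Polynomial MatrixGroups Matrix
open Filter IsDedekindDomain Field Polynomial NumberField
open Literature.NumberTheory.GaloisRepresentations Literature.NumberTheory.Automorphic
open Literature.NumberTheory.PAdicHodge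
open Summit.Langlands.Langlands.Theorems.FrobeniusUnitCarving (HasUnitFrobenius hasUnitFrobenius_of_compatibleFamily
  FramedRep.norm_eq_one_of_isRoot_charpoly)

namespace Summit.Langlands.Langlands.Theorems.FrobeniusUnitCarvingRankOne

variable {K : Type} [Field K] [NumberField K] {ℓ : ℕ} [Fact ℓ.Prime]

/-! ## §1. Weil's unit theorem in `λ`-adic form (unconditional) -/

/-- **Uniformizer values of an algebraic Hecke character are `ℓ'`-adic units away from `p_v`** (inverse form):
for `χ` algebraic, `v ∤ ℓ'` and `χ` unramified at `v`, `‖ι'⁻¹(χ(ϖ_v))⁻¹‖_{ℓ'} = 1`.  `ι'⁻¹(χ(ϖ_v))⁻¹` is the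
Frobenius eigenvalue at `v` of Weil's `ℓ'`-adic avatar (`HeckeCharacter.IsAlgebraic.exists_lAdic`), an
eigenvalue of a continuous representation of the compact group `Γ_K`, hence of norm `1`
(`FramedRep.norm_eq_one_of_isRoot_charpoly`). Weil (1956); Serre 1968 Ch. II §3.4.
[cite: SerreAbelianLadic1968, Ch. II §3.4] -/
theorem norm_symm_valueAtUniformizer_inv_eq_one {χ : HeckeCharacter K} (hχ : χ.IsAlgebraic)
    {ℓ' : ℕ} [Fact ℓ'.Prime] (ι' : PadicAlgCl ℓ' ≃+* ℂ) {v : HeightOneSpectrum (𝓞 K)}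
    (hvℓ' : ((ℓ' : ℕ) : 𝓞 K) ∉ v.asIdeal) (hv : χ.IsUnramifiedAt v) :
    ‖ι'.symm (χ.valueAtUniformizer v)⁻¹‖ = 1 := by
  obtain ⟨r, hr⟩ := hχ.exists_lAdic ι'
  obtain ⟨-, hP⟩ := hr v hvℓ' hv
  obtain ⟨𝔓, h𝔓⟩ := v.primesAbove_nonempty
  obtain ⟨σ, hσ⟩ := HeightOneSpectrum.exists_isArithFrobAt_of_mem_primesAbove_holds h𝔓
  have hroot : (FramedRep.charpoly r σ).IsRoot (ι'.symm (χ.valueAtUniformizer v)⁻¹) := by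
    rw [hP 𝔓 h𝔓 σ hσ]
    exact Polynomial.root_X_sub_C.mpr rfl
  haveI : CompactSpace (absoluteGaloisGroup K) := absoluteGaloisGroup_compactSpace K
  exact FramedRep.norm_eq_one_of_isRoot_charpoly r σ hroot

/-- **Uniformizer values of an algebraic Hecke character are `ℓ'`-adic units away from `p_v`**: for `χ`
algebraic, `v ∤ ℓ'` and `χ` unramified at `v`, `‖ι'⁻¹(χ(ϖ_v))‖_{ℓ'} = 1`. Weil (1956); Serre 1968 Ch. II §3.4.
[cite: SerreAbelianLadic1968, Ch. II §3.4] -/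
theorem norm_symm_valueAtUniformizer_eq_one {χ : HeckeCharacter K} (hχ : χ.IsAlgebraic)
    {ℓ' : ℕ} [Fact ℓ'.Prime] (ι' : PadicAlgCl ℓ' ≃+* ℂ) {v : HeightOneSpectrum (𝓞 K)}
    (hvℓ' : ((ℓ' : ℕ) : 𝓞 K) ∉ v.asIdeal) (hv : χ.IsUnramifiedAt v) :
    ‖ι'.symm (χ.valueAtUniformizer v)‖ = 1 := by
  have h := norm_symm_valueAtUniformizer_inv_eq_one hχ ι' hvℓ' hv
  rwa [map_inv₀, norm_inv, inv_eq_one] at h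

/-! ## §2. The kernel: a rank-one representation with a Hecke dictionary has unit Frobenius avatars -/

/-- **KERNEL (unconditional).**  If the rank-one `ρ : Γ_K → GL₁(ℚ̄_ℓ)` matches an ALGEBRAIC Hecke character
`χ` at almost all places (`χ`, `ρ` unramified and `ρ(Frob_v) = ι⁻¹(χ(ϖ_v))⁻¹`), then `ρ` has unit Frobenius
avatars almost everywhere (`HasUnitFrobenius K ℓ ι ρ`, the FU conclusion).  `ρ` is a member of the full
compatible family of Weil's avatars `χ_{ℓ',ι'}` (`HeckeCharacter.IsAlgebraic.exists_lAdic`) outside the finite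
exceptional set of the dictionary — the Frobenius polynomial of `ρ` at such `v` is unique
(a prime above `v` and a Frobenius at it exist), so it is `X - ι⁻¹(χ(ϖ_v))⁻¹`, whose `ι`-image is the
`ι'`-image of the avatar's `X - ι'⁻¹(χ(ϖ_v))⁻¹` — and `hasUnitFrobenius_of_compatibleFamily` applies.
Serre 1968 Ch. I §2.3 (compatible systems), Ch. II §3.4. [cite: SerreAbelianLadic1968, Ch. I §2.3] -/
theorem hasUnitFrobenius_of_heckeDictionary (ι : PadicAlgCl ℓ ≃+* ℂ) (ρ : FramedGaloisRep K (PadicAlgCl ℓ) 1)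
    {χ : HeckeCharacter K} (hχ : χ.IsAlgebraic)
    (hdict : ∀ᶠ v : HeightOneSpectrum (𝓞 K) in cofinite, χ.IsUnramifiedAt v ∧ ρ.IsUnramifiedAt v ∧
      ρ.HasFrobCharpolyAt v (X - C (ι.symm (χ.valueAtUniformizer v)⁻¹))) :
    HasUnitFrobenius K ℓ ι ρ := by
  refine hasUnitFrobenius_of_compatibleFamily ι ρ (Filter.eventually_cofinite.mp hdict) fun ℓ' _ ι' => ?_
  obtain ⟨r, hr⟩ := hχ.exists_lAdic ι'
  refine ⟨r, fun v hvS hvℓ' P hP => ?_⟩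
  have hv : χ.IsUnramifiedAt v ∧ ρ.IsUnramifiedAt v ∧
      ρ.HasFrobCharpolyAt v (X - C (ι.symm (χ.valueAtUniformizer v)⁻¹)) := by
    simpa only [Set.mem_setOf_eq, not_not] using hvS
  obtain ⟨-, hP'⟩ := hr v hvℓ' hv.1
  refine ⟨X - C (ι'.symm (χ.valueAtUniformizer v)⁻¹), hP', ?_⟩
  obtain ⟨𝔓, h𝔓⟩ := v.primesAbove_nonempty
  obtain ⟨σ, hσ⟩ := HeightOneSpectrum.exists_isArithFrobAt_of_mem_primesAbove_holds h𝔓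
  have hPeq : P = X - C (ι.symm (χ.valueAtUniformizer v)⁻¹) :=
    (hP 𝔓 h𝔓 σ hσ).symm.trans (hv.2.2 𝔓 h𝔓 σ hσ)
  rw [hPeq]
  simp only [Polynomial.map_sub, Polynomial.map_X, Polynomial.map_C, RingEquiv.coe_toRingHom,
    RingEquiv.apply_symm_apply]

/-! ## §3. Unconditional rung: the avatars of algebraic Hecke characters satisfy FU -/

/-- **Every model of the `ℓ`-adic avatar of an algebraic Hecke character satisfies the FU conclusion**
(unconditional): if `ρ` is unramified with `ρ(Frob_v) = ι⁻¹(χ(ϖ_v))⁻¹` at every `v ∤ ℓ` where `χ` is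
unramified, then `HasUnitFrobenius K ℓ ι ρ` — the dictionary holds almost everywhere since only finitely many
places lie above `ℓ` (`FramedGaloisRep.eventually_natCast_not_mem`) and `χ` ramifies at finitely many places
(`HeckeCharacter.finite_ramifiedPlaces_holds`, Tate). Weil (1956); Serre 1968 Ch. II §3.4.
[cite: SerreAbelianLadic1968, Ch. II §3.4] -/
theorem hasUnitFrobenius_of_isAvatar (ι : PadicAlgCl ℓ ≃+* ℂ) (ρ : FramedGaloisRep K (PadicAlgCl ℓ) 1)
    {χ : HeckeCharacter K} (hχ : χ.IsAlgebraic)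
    (havatar : ∀ v : HeightOneSpectrum (𝓞 K), ((ℓ : ℕ) : 𝓞 K) ∉ v.asIdeal → χ.IsUnramifiedAt v →
      ρ.IsUnramifiedAt v ∧ ρ.HasFrobCharpolyAt v (X - C (ι.symm (χ.valueAtUniformizer v)⁻¹))) :
    HasUnitFrobenius K ℓ ι ρ := by
  have hunr : ∀ᶠ v : HeightOneSpectrum (𝓞 K) in cofinite, χ.IsUnramifiedAt v :=
    (HeckeCharacter.finite_ramifiedPlaces_iff χ).mp (HeckeCharacter.finite_ramifiedPlaces_holds χ)
  refine hasUnitFrobenius_of_heckeDictionary ι ρ hχ ?_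
  filter_upwards [FramedGaloisRep.eventually_natCast_not_mem K ℓ, hunr] with v hvℓ hv
  exact ⟨hv, havatar v hvℓ hv⟩

/-- **Unconditional rung of FU**: for every algebraic Hecke character `χ` of a number field `K`, every `ℓ`
and `ι : ℚ̄_ℓ ≃ ℂ`, Weil's avatar `χ_{ℓ,ι} : Γ_K → GL₁(ℚ̄_ℓ)` (unramified with `χ_{ℓ,ι}(Frob_v) = ι⁻¹(χ(ϖ_v))⁻¹`
at all `v ∤ ℓ` unramified for `χ`) EXISTS (`HeckeCharacter.IsAlgebraic.exists_lAdic`, proved) and satisfies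
the FU conclusion `HasUnitFrobenius`. Weil (1956); Serre 1968 Ch. II §3.4. [cite: SerreAbelianLadic1968, Ch. II §3.4] -/
theorem exists_avatar_hasUnitFrobenius {χ : HeckeCharacter K} (hχ : χ.IsAlgebraic) (ι : PadicAlgCl ℓ ≃+* ℂ) :
    ∃ r : FramedGaloisRep K (PadicAlgCl ℓ) 1,
      (∀ v : HeightOneSpectrum (𝓞 K), ((ℓ : ℕ) : 𝓞 K) ∉ v.asIdeal → χ.IsUnramifiedAt v →
        r.IsUnramifiedAt v ∧ r.HasFrobCharpolyAt v (X - C (ι.symm (χ.valueAtUniformizer v)⁻¹))) ∧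
      HasUnitFrobenius K ℓ ι r := by
  obtain ⟨r, hr⟩ := hχ.exists_lAdic ι
  exact ⟨r, hr, hasUnitFrobenius_of_isAvatar ι r hχ hr⟩

/-! ## §4. FU at `n = 1` from the named fact, and from Tate's local theorem alone -/

/-- **FU for a de Rham rank-one `ρ`, granted the Hecke dictionary fact** (Patrikis 2019 Prop. 2.2.1;
Serre III §2.3 Thm. 2 + App. A): `ρ` de Rham above `ℓ` is the avatar of an algebraic `χ`
(`FramedGaloisRep.exists_heckeCharacter_of_isDeRhamFramed`, named fact, hypothesis `h`), so the kernel
`hasUnitFrobenius_of_heckeDictionary` applies.  No irreducibility, no unramified-a.e. clause is used.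
[cite: Patrikis2019, Prop. 2.2.1] [cite: SerreAbelianLadic1968, Ch. III §2.3 Thm. 2] -/
theorem hasUnitFrobenius_rankOne_of_namedFact (h : FramedGaloisRep.exists_heckeCharacter_of_isDeRhamFramed)
    (ι : PadicAlgCl ℓ ≃+* ℂ) (ρ : FramedGaloisRep K (PadicAlgCl ℓ) 1)
    (hdR : ∀ (v : HeightOneSpectrum (𝓞 K)) (hv : ((ℓ : ℕ) : 𝓞 K) ∈ v.asIdeal),
      (fontainePstAdicCompletion v ℓ hv).IsDeRhamFramed (ρ.toLocal v)) :
    HasUnitFrobenius K ℓ ι ρ := by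
  obtain ⟨χ, hχ, hdict⟩ := h K ℓ ρ hdR ι
  exact hasUnitFrobenius_of_heckeDictionary ι ρ hχ hdict

/-- **`stub_rankOne` of the registered FU skeleton (`Cruxes/FrobeniusUnits/Lines/birth.lean`), text VERBATIM,
from the named fact `FramedGaloisRep.exists_heckeCharacter_of_isDeRhamFramed` BY NAME** (Patrikis 2019
Prop. 2.2.1; Serre III §2.3 Thm. 2 + App. A): substitute `n = 1` and apply
`hasUnitFrobenius_rankOne_of_namedFact` to the de Rham half of the geometricity hypothesis.
[cite: Patrikis2019, Prop. 2.2.1] [cite: SerreAbelianLadic1968, Ch. III §2.3 Thm. 2] -/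
theorem rankOne_of_namedFact (h : FramedGaloisRep.exists_heckeCharacter_of_isDeRhamFramed) :
    ∀ (K : Type) [Field K] [NumberField K] (n : ℕ), 0 < n → n = 1 → ∀ (ℓ : ℕ) [Fact ℓ.Prime] (ι : PadicAlgCl ℓ ≃+* ℂ) (ρ : Literature.NumberTheory.GaloisRepresentations.FramedGaloisRep K (PadicAlgCl ℓ) n), ρ.toGaloisRep.IsIrreducible → ((∀ᶠ v : IsDedekindDomain.HeightOneSpectrum (NumberField.RingOfIntegers K) in cofinite, ρ.IsUnramifiedAt v) ∧ ∀ (v : IsDedekindDomain.HeightOneSpectrum (NumberField.RingOfIntegers K)) (hv : ((ℓ : ℕ) : NumberField.RingOfIntegers K) ∈ v.asIdeal), (Literature.NumberTheory.PAdicHodge.fontainePstAdicCompletion v ℓ hv).IsDeRhamFramed (ρ.toLocal v)) → ∀ᶠ v : IsDedekindDomain.HeightOneSpectrum (NumberField.RingOfIntegers K) in Filter.cofinite, ∀ P : Polynomial (PadicAlgCl ℓ), ρ.HasFrobCharpolyAt v P → ∀ β ∈ P.roots, ∀ (ℓ' : ℕ) [Fact ℓ'.Prime] (ι' : PadicAlgCl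 ℓ' ≃+* ℂ), ((ℓ' : ℕ) : NumberField.RingOfIntegers K) ∉ v.asIdeal → ‖ι'.symm (ι β)‖ = 1 := by
  intro K _ _ n _ hn1 ℓ _ ι ρ _ hgeo
  subst hn1
  exact hasUnitFrobenius_rankOne_of_namedFact h ι ρ hgeo.2

/-- **`stub_rankOne` (text VERBATIM) from TATE'S LOCAL THEOREM ALONE.**  `hloc` is, verbatim, the single local
hypothesis of the tree's reduction `FramedGaloisRep.exists_heckeCharacter_of_isDeRhamFramed_of_local` (Serre III
App. A6 Cor. 2; Conrad 2011 App. B Def. B.1 / Prop. B.4): a de Rham rank-one character of a characteristic-`0`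
non-archimedean local field of residue characteristic `ℓ` is algebraic near `1` on inertia.  So the `n = 1`
sector of FU is one local `p`-adic Hodge theory input (Sen) away from closing — the same input as the rank-one
automorphy leaf `PrimitiveRankLadder.RankOneAutomorphy` (`PrimitiveRankLadderRankOneAutomorphyOfTateLocal`).
[cite: SerreAbelianLadic1968, App. A6 Cor. 2] [cite: Conrad2011LiftingGlobal, App. B, Prop. B.4] -/
theorem rankOne_of_local
    (hloc : ∀ (F : Type) [Field F] [ValuativeRel F] [TopologicalSpace F] [IsNonarchimedeanLocalField F]
      [CharZero F] (ℓ : ℕ) [Fact ℓ.Prime] (hF : ValuativeRel.valuation F (ℓ : F) < 1)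
      (ρ : FramedRep (absoluteGaloisGroup F) (PadicAlgCl ℓ) 1),
      (Literature.NumberTheory.PAdicHodge.fontainePst F ℓ hF).IsDeRhamFramed ρ →
        ∃ V : Subgroup Fˣ, IsOpen (V : Set Fˣ) ∧
          ∃ (s : Finset (F →+* PadicAlgCl ℓ)) (n : (F →+* PadicAlgCl ℓ) → ℤ), (∀ e ∈ s, Continuous e) ∧
            ∀ w ∈ WeilGroup.inertia F, canonicalArtin F w ∈ V →
              ((ρ (WeilGroup.toAbsGalois F w) : GL (Fin 1) (PadicAlgCl ℓ)) :
                  Matrix (Fin 1) (Fin 1) (PadicAlgCl ℓ)) 0 0 =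
                ∏ e ∈ s, e ((canonicalArtin F w : Fˣ) : F) ^ n e) :
    ∀ (K : Type) [Field K] [NumberField K] (n : ℕ), 0 < n → n = 1 → ∀ (ℓ : ℕ) [Fact ℓ.Prime] (ι : PadicAlgCl ℓ ≃+* ℂ) (ρ : Literature.NumberTheory.GaloisRepresentations.FramedGaloisRep K (PadicAlgCl ℓ) n), ρ.toGaloisRep.IsIrreducible → ((∀ᶠ v : IsDedekindDomain.HeightOneSpectrum (NumberField.RingOfIntegers K) in cofinite, ρ.IsUnramifiedAt v) ∧ ∀ (v : IsDedekindDomain.HeightOneSpectrum (NumberField.RingOfIntegers K)) (hv : ((ℓ : ℕ) : NumberField.RingOfIntegers K) ∈ v.asIdeal), (Literature.NumberTheory.PAdicHodge.fontainePstAdicCompletion v ℓ hv).IsDeRhamFramed (ρ.toLocal v)) → ∀ᶠ v : IsDedekindDomain.HeightOneSpectrum (NumberField.RingOfIntegers K) in Filter.cofinite, ∀ P : Polynomial (PadicAlgCl ℓ), ρ.HasFrobCharpolyAt v P → ∀ β ∈ P.roots, ∀ (ℓ' : ℕ) [Fact ℓ'.Prime] (ι' : PadicAlgCl ℓ' ≃+*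 ℂ), ((ℓ' : ℕ) : NumberField.RingOfIntegers K) ∉ v.asIdeal → ‖ι'.symm (ι β)‖ = 1 :=
  rankOne_of_namedFact (FramedGaloisRep.exists_heckeCharacter_of_isDeRhamFramed_of_local hloc)

/-! ## §5. Reading on the ROUTE decl: FU by name from the two remaining stubs and the named fact -/

/-- **FU (`Theses.FrobeniusUnitCarving.FrobeniusUnits`, the ROUTE decl BY NAME) from the named Hecke-dictionary
fact and the skeleton's two remaining stubs** (`n = 2`, `n ≥ 3`, texts verbatim from `Lines/birth.lean`): the
reshaped three-stub composition with the rank-one stub DISCHARGED to `FramedGaloisRep.exists_heckeCharacter_of_isDeRhamFramed`.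
[cite: Patrikis2019, Prop. 2.2.1] [cite: SerreAbelianLadic1968, Ch. III §2.3 Thm. 2] -/
theorem frobeniusUnits_of_namedFact_of_rankTwo_of_higherRank
    (h : FramedGaloisRep.exists_heckeCharacter_of_isDeRhamFramed)
    (h2 : ∀ (K : Type) [Field K] [NumberField K] (n : ℕ), 0 < n → n = 2 → ∀ (ℓ : ℕ) [Fact ℓ.Prime] (ι : PadicAlgCl ℓ ≃+* ℂ) (ρ : Literature.NumberTheory.GaloisRepresentations.FramedGaloisRep K (PadicAlgCl ℓ) n), ρ.toGaloisRep.IsIrreducible → ((∀ᶠ v : IsDedekindDomain.HeightOneSpectrum (NumberField.RingOfIntegers K) in cofinite, ρ.IsUnramifiedAt v) ∧ ∀ (v : IsDedekindDomain.HeightOneSpectrum (NumberField.RingOfIntegers K)) (hv : ((ℓ : ℕ) : NumberField.RingOfIntegers K) ∈ v.asIdeal), (Literature.NumberTheory.PAdicHodge.fontainePstAdicCompletion v ℓ hv).IsDeRhamFramed (ρ.toLocal v)) → ∀ᶠ v : IsDedekindDomain.HeightOneSpectrum (NumberField.RingOfIntegers K) in Filter.cofinite, ∀ P : Polynomial (PadicAlgCl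 ℓ), ρ.HasFrobCharpolyAt v P → ∀ β ∈ P.roots, ∀ (ℓ' : ℕ) [Fact ℓ'.Prime] (ι' : PadicAlgCl ℓ' ≃+* ℂ), ((ℓ' : ℕ) : NumberField.RingOfIntegers K) ∉ v.asIdeal → ‖ι'.symm (ι β)‖ = 1)
    (h3 : ∀ (K : Type) [Field K] [NumberField K] (n : ℕ), 0 < n → 3 ≤ n → ∀ (ℓ : ℕ) [Fact ℓ.Prime] (ι : PadicAlgCl ℓ ≃+* ℂ) (ρ : Literature.NumberTheory.GaloisRepresentations.FramedGaloisRep K (PadicAlgCl ℓ) n), ρ.toGaloisRep.IsIrreducible → ((∀ᶠ v : IsDedekindDomain.HeightOneSpectrum (NumberField.RingOfIntegers K) in cofinite, ρ.IsUnramifiedAt v) ∧ ∀ (v : IsDedekindDomain.HeightOneSpectrum (NumberField.RingOfIntegers K)) (hv : ((ℓ : ℕ) : NumberField.RingOfIntegers K) ∈ v.asIdeal), (Literature.NumberTheory.PAdicHodge.fontainePstAdicCompletion v ℓ hv).IsDeRhamFramed (ρ.toLocal v)) → ∀ᶠ v : IsDedekindDomain.HeightOneSpectrum (NumberField.RingOfIntegers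 K) in Filter.cofinite, ∀ P : Polynomial (PadicAlgCl ℓ), ρ.HasFrobCharpolyAt v P → ∀ β ∈ P.roots, ∀ (ℓ' : ℕ) [Fact ℓ'.Prime] (ι' : PadicAlgCl ℓ' ≃+* ℂ), ((ℓ' : ℕ) : NumberField.RingOfIntegers K) ∉ v.asIdeal → ‖ι'.symm (ι β)‖ = 1) :
    Summit.Langlands.Langlands.Theses.FrobeniusUnitCarving.FrobeniusUnits := by
  intro K _ _ n hn ℓ _ ι ρ hirr hgeo
  rcases (by omega : n = 1 ∨ n = 2 ∨ 3 ≤ n) with h1 | h1 | h1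
  · exact rankOne_of_namedFact h K n hn h1 ℓ ι ρ hirr hgeo
  · exact h2 K n hn h1 ℓ ι ρ hirr hgeo
  · exact h3 K n hn h1 ℓ ι ρ hirr hgeo

end Summit.Langlands.Langlands.Theorems.FrobeniusUnitCarvingRankOne
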